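import Summits.ABC.ABC.Theses.CubicResolventAllowance
import Literature.NumberTheory.EllipticCurves.ModularDegreeMinimal
import Literature.NumberTheory.EllipticCurves.NewformPeterssonSize
import Literature.NumberTheory.DiophantineGeometry.MinimalDiscriminant
import Literature.NumberTheory.DiophantineGeometry.LocalReduction
import HarnessLib

/-!
# stub-ideation k2 (RESHAPE) — generation 11 sketch for `stub_complexCubic` (crux `IndexSzpiro`, stmt-ABC-22740)

Companion to `STUB-IDEAS-stub_complexCubic-2.md` (gen 11).  Gens 1–10 of this slot are carried BY REFERENCE
(`StubIdeas2G*Sketch.lean`, same directory).  This file only TYPES what gen 11 adds — the two RESHAPE menu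
cells no slot had run:

* §A  the SPECTRAL form of the stub (modular degree / Petersson norm): on the complex `r = 0` class the stub is,
  up to the in-tree identities (Zagier `4π²c²(f,f) = deg·covol`, Frey `2h = log deg − log(4π²c²(f,f))`,
  Silverman `log|Δ_min| < 12h + 16`, Murty–Hoffstein–Lockhart `(f,f) ≫ N^{1-ε}`), the class-restricted DEGREE
  CONJECTURE WITH ALLOWANCE `deg_min(W) ≤ C(ε)·|d_K|^{1/6}·N^{2+ε}` (`ClassDegreeBound (1/6) 2`); A2 is the
  transfer `ClassDegreeBound (1/6) 2 → Stub` (M, all inputs in the tree), A1 the model-invariance of the class.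
* §B  the STEM-FIELD form: base change to the cubic resolvent field `K` turns `r = 0` into "a `K`-rational point of
  order 2"; uniform Szpiro over cubic fields at discriminant exponent `a` (`StemFieldSzpiro a`) gives the stub on
  the SEMISTABLE slice exactly when `a ≤ 9` (B1; `a = 6` is Szpiro without allowance) — a conditional
  calibration, not progress (every notch `a < ∞` is open).

Nothing here is a tree proposal; `sorry` only in helper bodies (prover work / conditional calibrations).
-/

open Polynomial
open scoped NumberField

set_option linter.dupNamespace false

namespace Summit.ABC.ABC.Cruxes.IndexSzpiro.StubIdeas2G11

open Literature.NumberTheory.EllipticCurves.ModularForms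
  (minModularDegree nonempty_modularParametrizationData murty_petersson_newform_lower_bound)

/-! ## §0  The stub (verbatim) -/

/-- `stub_complexCubic`, verbatim (registered signature, skeleton sha d34fb8f2…). -/
def Stub : Prop :=
  ∀ ε : ℝ, 0 < ε → ∃ C : ℝ, ∀ (W : WeierstrassCurve ℚ) [W.IsElliptic] (K : Type) [Field K] [NumberField K],
    Irreducible W.twoTorsionPolynomial.toPoly → Module.finrank ℚ K = 3 →
    (∃ θ : K, aeval θ W.twoTorsionPolynomial.toPoly = 0) → NumberField.discr K < 0 →
    (W.minimalDiscriminantNorm ℤ : ℝ) ≤ C * |(NumberField.discr K : ℝ)| * (W.conductorNorm ℤ : ℝ) ^ (6 + ε)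

/-- The stub restricted to semistable curves (the slice on which §B's bookkeeping is exact). -/
def StubSemistable : Prop :=
  ∀ ε : ℝ, 0 < ε → ∃ C : ℝ, ∀ (W : WeierstrassCurve ℚ) [W.IsElliptic] (K : Type) [Field K] [NumberField K],
    W.IsSemistable ℤ → Irreducible W.twoTorsionPolynomial.toPoly → Module.finrank ℚ K = 3 →
    (∃ θ : K, aeval θ W.twoTorsionPolynomial.toPoly = 0) → NumberField.discr K < 0 →
    (W.minimalDiscriminantNorm ℤ : ℝ) ≤ C * |(NumberField.discr K : ℝ)| * (W.conductorNorm ℤ : ℝ) ^ (6 + ε)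

/-! ## §A  Spectral form: class-restricted degree conjecture with allowance -/

/-- `ClassDegreeBound A κ`: for every `ε > 0` one constant `C` bounds the MINIMAL MODULAR DEGREE of every
globally minimal member `W` of the complex `r = 0` class: `deg_min(W) ≤ C · |d_K|^A · N_W^{κ+ε}`.
Frey's degree conjecture is `A = 0, κ = 2` for all curves; Watkins' theorem refutes `κ < 7/6` (in tree:
`watkins2004_thm_5_1.*`, and `not_degreeConjectureWithExponent_of_lt_three_halves` for the route-normalised form). -/
def ClassDegreeBound (A κ : ℝ) : Prop :=
  ∀ ε : ℝ, 0 < ε → ∃ C : ℝ, ∀ (W : WeierstrassCurve ℚ) [W.IsElliptic] [W.IsGloballyMinimal]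
    [NeZero (W.conductorNorm ℤ)] (K : Type) [Field K] [NumberField K],
    Irreducible W.twoTorsionPolynomial.toPoly → Module.finrank ℚ K = 3 →
    (∃ θ : K, aeval θ W.twoTorsionPolynomial.toPoly = 0) → NumberField.discr K < 0 →
    (minModularDegree W (W.conductorNorm ℤ) : ℝ) ≤
      C * |(NumberField.discr K : ℝ)| ^ A * (W.conductorNorm ℤ : ℝ) ^ (κ + ε)

/-- **A1 (S).** Class membership is a property of the `ℚ`-isomorphism class: an admissible change of variables
`C • W` (`x = u²x' + r`) maps the 2-division cubic to `u⁻⁶ · ψ₂(u²X + r)`, so irreducibility and "`K` contains a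
root" are unchanged (`θ' = (θ - r)/u²`).  Needed to pass from the stub's arbitrary `W` to a globally minimal model
(`Summit.ABC.ABC.Theorems.SharpDegreeOfPolyDegree.Negative.exists_globallyMinimal_model`). -/
theorem A1_class_smul (W : WeierstrassCurve ℚ) (C : WeierstrassCurve.VariableChange ℚ)
    (K : Type) [Field K] [NumberField K] :
    (Irreducible (C • W).twoTorsionPolynomial.toPoly ↔ Irreducible W.twoTorsionPolynomial.toPoly) ∧
      ((∃ θ : K, aeval θ (C • W).twoTorsionPolynomial.toPoly = 0) ↔
        (∃ θ : K, aeval θ W.twoTorsionPolynomial.toPoly = 0)) := by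
  sorry

/-- **A2 (M).** The spectral notch `(A, κ) = (1/6, 2)` IS the stub, given modularity with an integral Manin constant
(`nonempty_modularParametrizationData`, BCDT + Edixhoven) and the Petersson lower bound
(`murty_petersson_newform_lower_bound`, Murty 1999 / Hoffstein–Lockhart): for a globally minimal model,
`log|Δ_min| < 12h + 16` (`pasten2024_log_minimalDiscriminant_le_holds`), `2h = log deg − log(4π²c²(f,f))`
(`ModularParametrizationData.two_mul_faltingsHeight_eq`), `c² ≥ 1`, `(f,f) ≥ c₀N^{1-ε'}`; hence
`log|Δ_min| ≤ 6 log deg_min − 6(1-ε') log N + O(1) ≤ log|d_K| + (6 + 6ε + 6ε') log N + O_ε(1)`; A1 moves the class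
hypotheses to the minimal model.  (With Pasten's TRIVIAL Petersson bound `IsNewformOf.peterssonProduct_re_ge`
instead of `hPet` one only gets the notch `(1/6, 1)`, which Watkins' lower bound `deg ≫ N^{7/6}/log N` refutes.) -/
theorem A2_stub_of_classDegreeBound (hmod : nonempty_modularParametrizationData)
    (hPet : murty_petersson_newform_lower_bound) : ClassDegreeBound (1 / 6) 2 → Stub := by
  sorry

/-- **A3 (S).** Monotonicity of the spectral dial (`|d_K| ≥ 1`, `N ≥ 1`). -/
theorem A3_classDegreeBound_mono {A A' κ κ' : ℝ} (hA : A ≤ A') (hκ : κ ≤ κ') :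
    ClassDegreeBound A κ → ClassDegreeBound A' κ' := by
  sorry

/-! ## §B  Stem-field form: uniform Szpiro over cubic fields for curves with a rational point of order 2 -/

/-- `StemFieldSzpiro a`: for every `ε > 0` one constant serves ALL cubic number fields `K` and all elliptic `V/K`
with a `K`-rational root of the 2-division cubic: `N_{K/ℚ}(𝔇_min(V/K)) ≤ C · |d_K|^a · N_{K/ℚ}(𝔣(V/K))^{6+ε}`
(tree currency: `minimalDiscriminantNorm (𝓞 K)`, `conductorNorm (𝓞 K)`).  Larger `a` = weaker statement;
every notch `a < ∞` is open (it contains Szpiro `6+ε` for the `r ≥ 1` classes over each fixed cubic field). -/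
def StemFieldSzpiro (a : ℝ) : Prop :=
  ∀ ε : ℝ, 0 < ε → ∃ C : ℝ, ∀ (K : Type) [Field K] [NumberField K], Module.finrank ℚ K = 3 →
    ∀ (V : WeierstrassCurve K) [V.IsElliptic], (∃ θ : K, V.twoTorsionPolynomial.toPoly.IsRoot θ) →
      (V.minimalDiscriminantNorm (𝓞 K) : ℝ) ≤
        C * |(NumberField.discr K : ℝ)| ^ a * (V.conductorNorm (𝓞 K) : ℝ) ^ (6 + ε)

/-- **B1 (L; CONDITIONAL CALIBRATION, do not staff).** On the semistable slice the notch `a = 9` is exactly the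
stub: for semistable `W/ℚ` in the class and `V = W_K`, `θ ∈ K` is a `K`-rational root;
`log N(𝔇_min(V)) = 3 log|Δ_min(W)|` (tree ✔ `log_minimalDiscriminantNorm_baseChange`, semistable); `V` is semistable
with `N(𝔣(V)) = ∏_{p ∣ N} p^{#{𝔭 ∣ p}} = 2^{O(1)} · N³/|d_K|` because at an odd multiplicative `p` one has
`K ⊗ ℚ_p ≃ ℚ_p × ℚ_p(√q)` (Tate), ramified iff `n_p` odd, so `Σ_{𝔭∣p} f_𝔭 = 3 − v_p(d_K)` (tame different);
hence `|Δ_min|³ ≤ C |d_K|^{a} (8N³/|d_K|)^{6+ε}`, i.e. `|Δ_min| ≤ C' |d_K|^{(a-6-ε)/3} N^{6+ε}`, `≤ |d_K|¹` iff `a ≤ 9+ε`.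
Off the semistable slice the transfer LEAKS `12 log p` at every additive prime `p ≥ 5` that is totally ramified
in `K` (type II*, `e = 3`: `ℚ`-side local excess `−4`, `K`-side `−6 − 9·2`), so no version of B1 reaches `Stub`. -/
theorem B1_stubSemistable_of_stemFieldSzpiro : StemFieldSzpiro 9 → StubSemistable := by
  sorry

/-- **B0 (S).** The semistable slice is a slice. -/
theorem B0_stubSemistable_of_stub : Stub → StubSemistable := by
  intro h ε hε
  obtain ⟨C, hC⟩ := h ε hε
  exact ⟨C, fun W _ K _ _ _ hirr hK hθ hd => hC W K hirr hK hθ hd⟩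

end Summit.ABC.ABC.Cruxes.IndexSzpiro.StubIdeas2G11
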